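import Summits.QuantumFields.YangMills.Theorems.BalabanUVNodesN19TargetClassWeightsTwoRunKeyed
import Literature.MathematicalPhysics.QuantumFieldTheory.Balaban1983to89.T4WeightBudgetKP

/-!
# BalabanUVNodes ∕ N20 (NE7b) — THE INSTANCE SOCKET for leaf D's `h20` at node U5d's keyed term data: the keyed `RelWeightBound` of n19-d's file B
# (`…N19TargetClassWeightsTwoRunKeyed` :169) ⟺ TWO DISPLAYED TERM-LEVEL relative bounds on run A's ∕ run B's BAD (2.18) SEQUENCES; and the same fed
# from per-(K,t) Kotecký–Preiss pinned-gas dominations of the bad sequences (`T4WeightBudgetKP.PolymerDom` BY NAME)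

Cell `pub-ymgap` (HUMAN RULING D-0062 Track A; director-ym №197 ∕ HUMAN RULING D-0149 width seats), seat `pub-ymgap-dag-n20-w1` (N20 NE7b WIDTH SEAT 1 of 3) gen 0;
item = plan g77 `W-SEAT-START-LIST.md` v3 §2 n20 ITEM 1 as RE-CUT by the lane word of dag-n20-d g28 (pub-ymgap INBOX l.24011, plan's word l.24047): «the INSTANCE
SOCKET at leaf D's keyed data … (DISPLAYED per-run domination of the keyed BAD fibre sums by a summable majorant) → `h20` in EXACTLY B's shape; the domination
itself = N20's XL body … NAME it OPEN».  Filed `--kind proof --supports stmt-QuantumFields-20544 --as helper` (K3⁷ `SpineGivenEndpointR13SepCoPH`); COUNT-NEUTRAL.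
[III] = [Balaban1988Convergent], [LF-II] = [Balaban1989LargeFieldII], [KP] = [KoteckyPreiss1986].

WHY THIS FILE.  Leaf D (`…N27SpineGivenEndpointR13SepCoPHKeyedCore.spineGivenEndpointR13SepCoPH_of_keyedFacesP`, p578137) reads node N20 as ONE binder
`h20 : … RelWeightBound (cr …).l₀ (cr …).T (cr …).A (cr …).B (cr …).Bad (cr …).W`, and n19-d's file B (:169, p571597) fixes the record's carriers at node U5d's
coupling-free two-run site keys: index type `Σ K, SiteSeqKey F (K₀ + K)`, class set `univ.image (kA K) ∪ univ.image (kB K)`, and KEYED weights = FIBRE SUMS of NODE 00's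
dressed class weights `classWeightOfDatum₉` over the key maps `kA K s = ⟨K, twoRunKeyA … s⟩` (run A, cutoff `K₀ + K`) ∕ `kB K s' = ⟨K, twoRunKeyB … s'⟩` (run B, cutoff
`K₀ + K + 1`).  The species-sum ∕ summability arithmetic behind `W` is typed three times already (`T4WeightBudget` §3, `T4WeightBudgetKP`, `…N20RenewalCurrency`) and is
NOT re-typed here.  What was missing is the SOCKET between the keyed binder and the place where Bałaban's analysis lives — the (2.18) SEQUENCES of the two runs
([III] (2.18) p. 257): both sides of `RelWeightBound.bad_left ∕ bad_right` for B's keyed families are FIBREWISE sums, so the keyed `h20` is EQUIVALENT to two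
term-level statements «the bad sequences of run A carry relative weight `≤ W K`», «the bad sequences of run B carry relative weight `≤ W K`» (§1 ★ + its converse),
where «`s` bad» means «the KEY of `s` lies in `Bad K t`» (run A: `kA K` is injective, B §1, so this is a property of the single term; run B: a whole block-down fibre
is bad or not — node U5d's partial summation).  §1 also transfers the sum-only currency of `T4WeightBudgetKP` §4: a per-(K,t) KP pinned-gas DOMINATION of a run's
bad sequences IS `PolymerDom` for the keyed family (`polymerDom_keyed_of_termDom`), whence the keyed `RelWeightBound` at `W K = 1 − e^{−(S_A K + S_B K)}` or at a
pinned slot, BY NAME (`PolymerDom.mono`, `relWeightBound_of_polymerDom`, `PolymerDom.bad_le`).  §2 is §1 at B :169's objects VERBATIM.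
Precedent (cited, not duplicated): `T4LiveClassFibration` §1 `relWeightBound_of_classes` = the ONE-type pushforward class ⇒ term along one fibration `π`; here the direction
is term ⇒ keyed, with TWO cutoff-dependent source types keyed by two different maps into one key type.

CONTENTS (theorems only; 0 `def`, 0 `sorry`; Mathlib `Finset.sum_fiberwise_eq_sum_filter` ∕ `Finset.sum_fiberwise_of_maps_to` + tree shapes BY NAME):
* §1 ABSTRACT KEYED FIBRE SUMS (key type `κ`, per-cutoff finite source types `σ K` ∕ `σA K` ∕ `σB K`, key maps, term weights; class set `T K` containing every key):
  `sum_keyedFibre_eq_sum_filter_mem` · `sum_keyedFibre_classSet` · `keyedFibre_nonneg` · `keyedBound_iff_termBound` · `filter_key_mem_filter_eq` · `polymerDom_keyed_of_termDom` ·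
  ★ `relWeightBound_keyed_of_termBounds` · ★ `termBounds_of_relWeightBound_keyed` · ★ `relWeightBound_keyed_of_termBounds_filter` (bad class cut out by a KEY
  PREDICATE — dag-n20-d's persistence predicate's shape; `bad_subset` free) · ★ `relWeightBound_keyed_of_termMajorants_slot` ·
  ★ `relWeightBound_keyed_of_termPolymerDom` · `relWeightBound_keyed_of_termPolymerDom_slot`; image-union class set: `mem_imageUnion_left ∕ _right`.
* §2 AT NODE U5d's SIGMA-PACKED TWO-RUN SITE KEYS (B :169's `h20` VERBATIM, `ϑ := (θ.liveRepin₁₃ F N).toStage9Params`): ★★ `keyedRelWeight_twoRunKeyed_of_termBounds` ·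
  ★★ `termBounds_of_keyedRelWeight_twoRunKeyed` · ★★ `keyedRelWeight_twoRunKeyed_of_termPolymerDom` · `keyedRelWeight_twoRunKeyed_of_termPolymerDom_slot`.

(α) READING: NONE FIXED.  `Bad : ℕ → ℝ → Finset (Σ K, SiteSeqKey F (K₀ + K))` stays B's FREE parameter (NC-NE7b-α UNRULED, chair ASK-1); dag-n20-d's key-level
persistence predicate (`Node00/TwoRunSitePersistence`: `KeyOldLargeField jcut`, `Bad K t := badKeysSigma F (T K) jcut`, INTENT-2 l.24056, plan GO l.24047) plugs in by
substitution (§1 ★ `…_of_termBounds_filter` is its shape); n20-w2 ∕ n20-w3 read the SAME binder (one class set for `bad_left` ∕ `bad_right` ∕ `hedge`).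

HONEST FRAMING.  Count-neutral kernel bookkeeping (finite sums).  It proves NO estimate: the displayed term-level bounds `hA` ∕ `hB` (resp. the pinned-gas
dominations `hdomA` ∕ `hdomB`) FOR BAŁABAN's CLASS WEIGHTS are node N20's XL body — the located wall of record ((MSP) multiscale cells-Peierls of the bare
Wilson–Gibbs state on admissible patterns, dag-n20-d `HANDOFF.g7.md` §3 + addenda (v)–(xiv); (W♮) + (T♯) + regime, dag-n20-c `N20-S1-RESIDUAL.md`) — NAMED OPEN,
NOT claimed, inhabited for no Bałaban family today (A6: LOCATED; the converse ★ makes §1∕§2 an EQUIVALENCE, so the socket loses nothing and is not a vacuous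
implication as a statement).  `RelWeightBound` ALONE is junk-inhabited by `Bad := ∅, W := 0` (`…N18KingModelCauchy.relWeightBound_empty`); content only
jointly with `hedge` on `T K ∖ Bad K t` (n20-w3's companion).  NE7b is the cell `pub-balaban`'s OWN estimate — NOT PRINTED for d = 4, NOT PROVED; printed MODEL
[King1986] (3.10)–(3.11) p. 656; (α)-instance 0∕1; N20 NOT discharged; K3⁷ NOT closed; no K-item closes; counts unmoved (typed 28∕28 · discharged 5∕27).  One
finite `𝕋⁴_{L^K}` programme at fixed `ε = L^{−K}` along two consecutive cutoffs, Bałaban AS PRINTED; the YM mass gap (Clay) is NOT proved by any of this — R4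
closes the conditional finite-𝕋⁴ rung `BalabanLadder.UV` only; nothing continuum ∕ ℝ⁴ ∕ OS.  No `instance`, no `notation`, no `def`.
Sources (locators only): [III] (2.18) p. 257, (2.1) p. 254, (2.5) p. 255; [LF-II] (1.90)–(1.92) p. 388; [KP] Theorem p. 492; [King1986] (3.10) p. 656.  No decl below carries a cite tag.
-/

noncomputable section

namespace Summit.QuantumFields.YangMills.BalabanUVNodes.N20KeyedRelWeightSocket

open Literature.MathematicalPhysics.QuantumFieldTheory.Balaban1983to89 Literature.MathematicalPhysics.QuantumFieldTheory.Balaban1983to89.Node00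
open scoped BigOperators
open T4Continuum B14.Eq218Concrete Summit.QuantumFields.BalabanUV.T4Continuum.Spine
open T4WeightBudget (RelWeightBound)
open T4WeightBudgetKP (PinnedGas PolymerDom relWeightBound_of_polymerDom)

/-! ## §1 ABSTRACT KEYED FIBRE SUMS: the keyed relative bound IS the term-level relative bound on the terms keyed into the bad key set -/

section OneRun

variable {κ : Type*} [DecidableEq κ]

/-- **Σ OVER A KEY SET OF THE KEYED FIBRE SUMS = Σ OVER THE TERMS KEYED INTO IT** (Mathlib `Finset.sum_fiberwise_eq_sum_filter` at `s = univ`). [bookkeeping] -/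
theorem sum_keyedFibre_eq_sum_filter_mem {σ : Type*} [Fintype σ] (k : σ → κ) (f : σ → ℝ) (S : Finset κ) :
    ∑ x ∈ S, ∑ s ∈ Finset.univ.filter (fun s : σ => k s = x), f s = ∑ s ∈ Finset.univ.filter (fun s : σ => k s ∈ S), f s :=
  Finset.sum_fiberwise_eq_sum_filter _ _ _ _

/-- **Σ OVER A CLASS SET CONTAINING EVERY KEY = THE RUN's FULL TERM SUM** (Mathlib `Finset.sum_fiberwise_of_maps_to`). [bookkeeping] -/
theorem sum_keyedFibre_classSet {σ : Type*} [Fintype σ] (k : σ → κ) (f : σ → ℝ) {T : Finset κ} (hk : ∀ s, k s ∈ T) :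
    ∑ x ∈ T, ∑ s ∈ Finset.univ.filter (fun s : σ => k s = x), f s = ∑ s, f s :=
  Finset.sum_fiberwise_of_maps_to (fun s _ => hk s) _

/-- Keyed fibre sums of nonnegative term weights are nonnegative. [bookkeeping] -/
theorem keyedFibre_nonneg {σ : Type*} [Fintype σ] (k : σ → κ) {f : σ → ℝ} (hf : ∀ s, 0 ≤ f s) (x : κ) :
    0 ≤ ∑ s ∈ Finset.univ.filter (fun s : σ => k s = x), f s :=
  Finset.sum_nonneg fun s _ => hf s

/-- **THE KEYED RELATIVE BOUND IS THE TERM-LEVEL RELATIVE BOUND**: for a class set `T` containing every key, «Σ_{x ∈ Bad} (fibre sum) ≤ W · Σ_{x ∈ T} (fibre sum)» ↔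
«Σ_{s : k s ∈ Bad} f s ≤ W · Σ_s f s». [bookkeeping] -/
theorem keyedBound_iff_termBound {σ : Type*} [Fintype σ] (k : σ → κ) (f : σ → ℝ) {T : Finset κ} (hk : ∀ s, k s ∈ T) (Bad : Finset κ) (W : ℝ) :
    (∑ x ∈ Bad, ∑ s ∈ Finset.univ.filter (fun s : σ => k s = x), f s ≤ W * ∑ x ∈ T, ∑ s ∈ Finset.univ.filter (fun s : σ => k s = x), f s) ↔
      (∑ s ∈ Finset.univ.filter (fun s : σ => k s ∈ Bad), f s ≤ W * ∑ s, f s) := by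
  rw [sum_keyedFibre_eq_sum_filter_mem, sum_keyedFibre_classSet k f hk]

/-- For a bad key class CUT OUT OF THE CLASS SET BY A KEY PREDICATE `P`, «the key of `s` is bad» reads `P (k s)` (every key lies in the class set). [bookkeeping] -/
theorem filter_key_mem_filter_eq {σ : Type*} [Fintype σ] (k : σ → κ) {T : Finset κ} (hk : ∀ s, k s ∈ T) (P : κ → Prop) [DecidablePred P] :
    Finset.univ.filter (fun s : σ => k s ∈ T.filter P) = Finset.univ.filter (fun s : σ => P (k s)) :=
  Finset.filter_congr fun s _ => by simp only [Finset.mem_filter, hk s, true_and]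

variable {σ : ℕ → Type*} [∀ K, Fintype (σ K)] (k : (K : ℕ) → σ K → κ) (f : (K : ℕ) → ℝ → σ K → ℝ) {T : ℕ → Finset κ}
  {l₀ : ℝ} {Bad : ℕ → ℝ → Finset κ} {S : ℕ → ℝ}

/-- **A PER-(K,t) KP PINNED-GAS DOMINATION OF A RUN's BAD TERMS IS `PolymerDom` FOR THE KEYED FAMILY** (`T4WeightBudgetKP` §4; the two sum identities).  DISPLAYED:
every key in the class set, `Bad ⊆ T`, and at each `(K, t)`, `|t| ≤ l₀`, a KP pinned gas `G` and `c ≥ 0` with `Σ_{s : k K s ∈ Bad K t} f ≤ c·G.bad`, `c·G.total ≤ Σ_s f`,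
`G.pinnedSize ≤ S K` ([LF-II] (1.90)–(1.92) p. 388 is the printed per-step ingredient; the history-indexed domination is NOT PRINTED — hypothesis). [bookkeeping] -/
theorem polymerDom_keyed_of_termDom (hk : ∀ K s, k K s ∈ T K) (hBad : ∀ K t, |t| ≤ l₀ → Bad K t ⊆ T K)
    (hdom : ∀ K t, |t| ≤ l₀ → ∃ G : PinnedGas, ∃ c : ℝ, 0 ≤ c ∧ G.IsKP ∧
      ∑ s ∈ Finset.univ.filter (fun s : σ K => k K s ∈ Bad K t), f K t s ≤ c * G.bad ∧ c * G.total ≤ ∑ s, f K t s ∧ G.pinnedSize ≤ S K) :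
    PolymerDom l₀ T (fun K t x => ∑ s ∈ Finset.univ.filter (fun s : σ K => k K s = x), f K t s) Bad S where
  bad_subset := hBad
  dom K t ht := by
    obtain ⟨G, c, hc, hKP, hb, hT, hS⟩ := hdom K t ht
    refine ⟨G, c, hc, hKP, ?_, ?_, hS⟩
    · rw [sum_keyedFibre_eq_sum_filter_mem]; exact hb
    · rw [sum_keyedFibre_classSet (k K) (f K t) (hk K)]; exact hT

end OneRun

section TwoRuns

variable {κ : Type*} [DecidableEq κ] {σA σB : ℕ → Type*} [∀ K, Fintype (σA K)] [∀ K, Fintype (σB K)]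
  (kA : (K : ℕ) → σA K → κ) (kB : (K : ℕ) → σB K → κ) (a : (K : ℕ) → ℝ → σA K → ℝ) (b : (K : ℕ) → ℝ → σB K → ℝ)
  {T : ℕ → Finset κ} {l₀ : ℝ} {Bad : ℕ → ℝ → Finset κ} {W SA SB : ℕ → ℝ}

/-- Run A's keys lie in the image-union class set. [bookkeeping] -/
theorem mem_imageUnion_left (K : ℕ) (s : σA K) : kA K s ∈ Finset.univ.image (kA K) ∪ Finset.univ.image (kB K) :=
  Finset.mem_union_left _ (Finset.mem_image_of_mem _ (Finset.mem_univ s))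

/-- Run B's keys lie in the image-union class set. [bookkeeping] -/
theorem mem_imageUnion_right (K : ℕ) (s' : σB K) : kB K s' ∈ Finset.univ.image (kA K) ∪ Finset.univ.image (kB K) :=
  Finset.mem_union_right _ (Finset.mem_image_of_mem _ (Finset.mem_univ s'))

/-- ★ **THE SOCKET: KEYED `RelWeightBound` FROM TWO TERM-LEVEL RELATIVE BOUNDS.**  Class set `T K` containing every key of both runs, keyed weights = the fibre sums of
the runs' term weights `a K t` ∕ `b K t` along `kA K` ∕ `kB K`.  DISPLAYED: `Bad ⊆ T`, `0 ≤ W < 1`, `Σ W < ∞`, and per run «the terms keyed into `Bad K t` carry relative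
weight `≤ W K`» — run A `Σ_{s : kA K s ∈ Bad K t} a ≤ W K · Σ_s a`, run B `Σ_{s' : kB K s' ∈ Bad K t} b ≤ W K · Σ_{s'} b`.  Exact; no sign condition. [bookkeeping] -/
theorem relWeightBound_keyed_of_termBounds (hkA : ∀ K s, kA K s ∈ T K) (hkB : ∀ K s', kB K s' ∈ T K)
    (hBad : ∀ K t, |t| ≤ l₀ → Bad K t ⊆ T K) (hW0 : ∀ K, 0 ≤ W K) (hW1 : ∀ K, W K < 1) (hWs : Summable W)
    (hA : ∀ K t, |t| ≤ l₀ → ∑ s ∈ Finset.univ.filter (fun s : σA K => kA K s ∈ Bad K t), a K t s ≤ W K * ∑ s, a K t s)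
    (hB : ∀ K t, |t| ≤ l₀ → ∑ s' ∈ Finset.univ.filter (fun s' : σB K => kB K s' ∈ Bad K t), b K t s' ≤ W K * ∑ s', b K t s') :
    RelWeightBound l₀ T (fun K t x => ∑ s ∈ Finset.univ.filter (fun s : σA K => kA K s = x), a K t s)
      (fun K t x => ∑ s' ∈ Finset.univ.filter (fun s' : σB K => kB K s' = x), b K t s') Bad W where
  bad_subset := hBad
  nonneg := hW0
  lt_one := hW1
  summable := hWs
  bad_left K t ht := (keyedBound_iff_termBound (kA K) (a K t) (hkA K) (Bad K t) (W K)).2 (hA K t ht)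
  bad_right K t ht := (keyedBound_iff_termBound (kB K) (b K t) (hkB K) (Bad K t) (W K)).2 (hB K t ht)

/-- ★ **THE CONVERSE — THE SOCKET IS LOSS-FREE**: a keyed `RelWeightBound` for the fibre-sum families over a class set containing every key SAYS exactly the two term-level
relative bounds of `relWeightBound_keyed_of_termBounds` (so whoever inhabits leaf D's `h20` at B's data proves precisely these, no more and no less). [bookkeeping] -/
theorem termBounds_of_relWeightBound_keyed (hkA : ∀ K s, kA K s ∈ T K) (hkB : ∀ K s', kB K s' ∈ T K)
    (h : RelWeightBound l₀ T (fun K t x => ∑ s ∈ Finset.univ.filter (fun s : σA K => kA K s = x), a K t s)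
      (fun K t x => ∑ s' ∈ Finset.univ.filter (fun s' : σB K => kB K s' = x), b K t s') Bad W) :
    (∀ K t, |t| ≤ l₀ → ∑ s ∈ Finset.univ.filter (fun s : σA K => kA K s ∈ Bad K t), a K t s ≤ W K * ∑ s, a K t s) ∧
    (∀ K t, |t| ≤ l₀ → ∑ s' ∈ Finset.univ.filter (fun s' : σB K => kB K s' ∈ Bad K t), b K t s' ≤ W K * ∑ s', b K t s') :=
  ⟨fun K t ht => (keyedBound_iff_termBound (kA K) (a K t) (hkA K) (Bad K t) (W K)).1 (h.bad_left K t ht),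
    fun K t ht => (keyedBound_iff_termBound (kB K) (b K t) (hkB K) (Bad K t) (W K)).1 (h.bad_right K t ht)⟩

/-- ★ **THE SOCKET FOR A BAD CLASS CUT OUT BY A KEY PREDICATE** `Bad K t := (T K).filter (P K t)` — the shape of dag-n20-d's key-level persistence predicate
(`Node00/TwoRunSitePersistence`: «an OLD large-field region at a level `≤ jcut K`», announced pub-ymgap INBOX l.24056; any `P` here): `bad_subset` is FREE and the two
displayed term-level bounds read «Σ over the terms `s` with `P K t (kA K s)`» ∕ «… `P K t (kB K s')`» (`filter_key_mem_filter_eq`). [bookkeeping] -/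
theorem relWeightBound_keyed_of_termBounds_filter (P : ℕ → ℝ → κ → Prop) [∀ K t, DecidablePred (P K t)]
    (hkA : ∀ K s, kA K s ∈ T K) (hkB : ∀ K s', kB K s' ∈ T K) (hW0 : ∀ K, 0 ≤ W K) (hW1 : ∀ K, W K < 1) (hWs : Summable W)
    (hA : ∀ K t, |t| ≤ l₀ → ∑ s ∈ Finset.univ.filter (fun s : σA K => P K t (kA K s)), a K t s ≤ W K * ∑ s, a K t s)
    (hB : ∀ K t, |t| ≤ l₀ → ∑ s' ∈ Finset.univ.filter (fun s' : σB K => P K t (kB K s')), b K t s' ≤ W K * ∑ s', b K t s') :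
    RelWeightBound l₀ T (fun K t x => ∑ s ∈ Finset.univ.filter (fun s : σA K => kA K s = x), a K t s)
      (fun K t x => ∑ s' ∈ Finset.univ.filter (fun s' : σB K => kB K s' = x), b K t s') (fun K t => (T K).filter (P K t)) W :=
  relWeightBound_keyed_of_termBounds kA kB a b hkA hkB (fun K t _ => Finset.filter_subset _ _) hW0 hW1 hWs
    (fun K t ht => by rw [filter_key_mem_filter_eq (kA K) (hkA K)]; exact hA K t ht)
    (fun K t ht => by rw [filter_key_mem_filter_eq (kB K) (hkB K)]; exact hB K t ht)

/-- ★ **THE SOCKET AT A PINNED SLOT FROM PER-RUN MAJORANTS** (record-matching form, as `…N20RenewalCurrency.relWeightBound_of_slotDom_slot`): term-level relative bounds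
with the runs' OWN majorants `S_A K` ∕ `S_B K`, nonnegative term weights, and a slot `W` with `S_A K ≤ W K`, `S_B K ≤ W K`, `0 ≤ W K < 1`, `Σ W < ∞` (the species-sum ∕
summability arithmetic producing such a `W` is `T4WeightBudget` §3 — not re-typed) ⇒ keyed `RelWeightBound` at `W`. [bookkeeping] -/
theorem relWeightBound_keyed_of_termMajorants_slot (hkA : ∀ K s, kA K s ∈ T K) (hkB : ∀ K s', kB K s' ∈ T K)
    (hBad : ∀ K t, |t| ≤ l₀ → Bad K t ⊆ T K)
    (ha0 : ∀ K t, |t| ≤ l₀ → ∀ s, 0 ≤ a K t s) (hb0 : ∀ K t, |t| ≤ l₀ → ∀ s', 0 ≤ b K t s')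
    (hA : ∀ K t, |t| ≤ l₀ → ∑ s ∈ Finset.univ.filter (fun s : σA K => kA K s ∈ Bad K t), a K t s ≤ SA K * ∑ s, a K t s)
    (hB : ∀ K t, |t| ≤ l₀ → ∑ s' ∈ Finset.univ.filter (fun s' : σB K => kB K s' ∈ Bad K t), b K t s' ≤ SB K * ∑ s', b K t s')
    (hWA : ∀ K, SA K ≤ W K) (hWB : ∀ K, SB K ≤ W K) (hW0 : ∀ K, 0 ≤ W K) (hW1 : ∀ K, W K < 1) (hWs : Summable W) :
    RelWeightBound l₀ T (fun K t x => ∑ s ∈ Finset.univ.filter (fun s : σA K => kA K s = x), a K t s)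
      (fun K t x => ∑ s' ∈ Finset.univ.filter (fun s' : σB K => kB K s' = x), b K t s') Bad W :=
  relWeightBound_keyed_of_termBounds kA kB a b hkA hkB hBad hW0 hW1 hWs
    (fun K t ht => (hA K t ht).trans (mul_le_mul_of_nonneg_right (hWA K) (Finset.sum_nonneg fun s _ => ha0 K t ht s)))
    (fun K t ht => (hB K t ht).trans (mul_le_mul_of_nonneg_right (hWB K) (Finset.sum_nonneg fun s' _ => hb0 K t ht s')))

/-- ★ **THE SOCKET IN THE KP CURRENCY** (`T4WeightBudgetKP` §4 BY NAME): per-(K,t) KP pinned-gas dominations of run A's bad terms (budget `S_A`) and of run B's (budget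
`S_B`), `S_A, S_B ≥ 0` summable ⇒ keyed `RelWeightBound` at `W K = 1 − exp (−(S_A K + S_B K))` (`polymerDom_keyed_of_termDom` per run, both moved to the common budget
by `PolymerDom.mono`, then `relWeightBound_of_polymerDom`; `W < 1` automatic, `Σ W ≤ Σ (S_A + S_B)`). [bookkeeping] -/
theorem relWeightBound_keyed_of_termPolymerDom (hkA : ∀ K s, kA K s ∈ T K) (hkB : ∀ K s', kB K s' ∈ T K)
    (hBad : ∀ K t, |t| ≤ l₀ → Bad K t ⊆ T K) (hSA : ∀ K, 0 ≤ SA K) (hSB : ∀ K, 0 ≤ SB K) (hsA : Summable SA) (hsB : Summable SB)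
    (hdomA : ∀ K t, |t| ≤ l₀ → ∃ G : PinnedGas, ∃ c : ℝ, 0 ≤ c ∧ G.IsKP ∧
      ∑ s ∈ Finset.univ.filter (fun s : σA K => kA K s ∈ Bad K t), a K t s ≤ c * G.bad ∧ c * G.total ≤ ∑ s, a K t s ∧ G.pinnedSize ≤ SA K)
    (hdomB : ∀ K t, |t| ≤ l₀ → ∃ G : PinnedGas, ∃ c : ℝ, 0 ≤ c ∧ G.IsKP ∧
      ∑ s' ∈ Finset.univ.filter (fun s' : σB K => kB K s' ∈ Bad K t), b K t s' ≤ c * G.bad ∧ c * G.total ≤ ∑ s', b K t s' ∧ G.pinnedSize ≤ SB K) :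
    RelWeightBound l₀ T (fun K t x => ∑ s ∈ Finset.univ.filter (fun s : σA K => kA K s = x), a K t s)
      (fun K t x => ∑ s' ∈ Finset.univ.filter (fun s' : σB K => kB K s' = x), b K t s') Bad fun K => 1 - Real.exp (-(SA K + SB K)) :=
  relWeightBound_of_polymerDom (fun K => add_nonneg (hSA K) (hSB K)) (hsA.add hsB)
    ((polymerDom_keyed_of_termDom kA a hkA hBad hdomA).mono fun K => le_add_of_nonneg_right (hSB K))
    ((polymerDom_keyed_of_termDom kB b hkB hBad hdomB).mono fun K => le_add_of_nonneg_left (hSA K))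

/-- **THE SOCKET IN THE KP CURRENCY AT A PINNED SLOT**: the same two dominations with their own budgets and a slot `W` dominating `1 − e^{−S_A K}`, `1 − e^{−S_B K}`,
`0 ≤ W K < 1`, `Σ W < ∞`, nonnegative term weights ⇒ keyed `RelWeightBound` at `W` (`PolymerDom.bad_le` per run). [bookkeeping] -/
theorem relWeightBound_keyed_of_termPolymerDom_slot (hkA : ∀ K s, kA K s ∈ T K) (hkB : ∀ K s', kB K s' ∈ T K)
    (hBad : ∀ K t, |t| ≤ l₀ → Bad K t ⊆ T K)
    (ha0 : ∀ K t, |t| ≤ l₀ → ∀ s, 0 ≤ a K t s) (hb0 : ∀ K t, |t| ≤ l₀ → ∀ s', 0 ≤ b K t s')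
    (hdomA : ∀ K t, |t| ≤ l₀ → ∃ G : PinnedGas, ∃ c : ℝ, 0 ≤ c ∧ G.IsKP ∧
      ∑ s ∈ Finset.univ.filter (fun s : σA K => kA K s ∈ Bad K t), a K t s ≤ c * G.bad ∧ c * G.total ≤ ∑ s, a K t s ∧ G.pinnedSize ≤ SA K)
    (hdomB : ∀ K t, |t| ≤ l₀ → ∃ G : PinnedGas, ∃ c : ℝ, 0 ≤ c ∧ G.IsKP ∧
      ∑ s' ∈ Finset.univ.filter (fun s' : σB K => kB K s' ∈ Bad K t), b K t s' ≤ c * G.bad ∧ c * G.total ≤ ∑ s', b K t s' ∧ G.pinnedSize ≤ SB K)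
    (hWA : ∀ K, 1 - Real.exp (-SA K) ≤ W K) (hWB : ∀ K, 1 - Real.exp (-SB K) ≤ W K)
    (hW0 : ∀ K, 0 ≤ W K) (hW1 : ∀ K, W K < 1) (hWs : Summable W) :
    RelWeightBound l₀ T (fun K t x => ∑ s ∈ Finset.univ.filter (fun s : σA K => kA K s = x), a K t s)
      (fun K t x => ∑ s' ∈ Finset.univ.filter (fun s' : σB K => kB K s' = x), b K t s') Bad W where
  bad_subset := hBad
  nonneg := hW0
  lt_one := hW1
  summable := hWs
  bad_left K t ht :=
    ((polymerDom_keyed_of_termDom kA a hkA hBad hdomA).bad_le K t ht).trans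
      (mul_le_mul_of_nonneg_right (hWA K) (Finset.sum_nonneg fun x _ => keyedFibre_nonneg (kA K) (ha0 K t ht) x))
  bad_right K t ht :=
    ((polymerDom_keyed_of_termDom kB b hkB hBad hdomB).bad_le K t ht).trans
      (mul_le_mul_of_nonneg_right (hWB K) (Finset.sum_nonneg fun x _ => keyedFibre_nonneg (kB K) (hb0 K t ht) x))

end TwoRuns

/-! ## §2 AT NODE U5d's SIGMA-PACKED TWO-RUN SITE KEYS — n19-d B :169's `h20` binder VERBATIM, fed by two TERM-LEVEL statements on the runs' (2.18) sequences -/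

section TwoRunKeyed

variable (F : T4Family) (N : ℕ) [NeZero N] [∀ Kc, DecidableEq (SiteSeqKey F Kc)]

/-- ★★ **LEAF D's `h20` AT B's KEYED DATA FROM TWO TERM-LEVEL RELATIVE BOUNDS ON THE RUNS' BAD SEQUENCES.**  At the re-pin `ϑ := (θ.liveRepin₁₃ F N).toStage9Params`, for the
run families `⟨K₀ + K, mA K, cA K⟩` ∕ `⟨K₀ + K + 1, mB K, cB K⟩` with histories `gA K` ∕ `gB K`: IF `Bad K t` consists of classes, `0 ≤ W < 1`, `Σ W < ∞`, and — THE BODY OF N20,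
DISPLAYED, NOT PROVED — run A's (2.18) sequences at cutoff `K₀ + K` whose two-run site key lies in `Bad K t` carry relative class weight `≤ W K` and run B's sequences at cutoff
`K₀ + K + 1` whose block-down key lies in `Bad K t` carry relative class weight `≤ W K` (both uniformly in `|t| ≤ l₀`), THEN the `RelWeightBound` binder `h20` of B
`matching_scheme_of_coreEdge_twoRunKeyed_liveRepin₁₃` (:169) holds VERBATIM (§1 ★ at `kA K s := ⟨K, twoRunKeyA … s⟩`, `kB K s' := ⟨K, twoRunKeyB … s'⟩`). [bookkeeping] -/
theorem keyedRelWeight_twoRunKeyed_of_termBounds (θ : Stage13Params F N) (hM : 0 < θ.τ9.M) (D : FiniteEpsData F (SU N)) (g₀ : ℕ → ℝ) (os : List (ULoop F))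
    (K₀ : ℕ) (mA mB : ℕ → ℕ) (cA cB : ℕ → ℝ) (gA gB : ℕ → ℕ → ℝ)
    {l₀ : ℝ} {Bad : ℕ → ℝ → Finset (Σ K, SiteSeqKey F (K₀ + K))} {W : ℕ → ℝ}
    (hBad : ∀ K t, |t| ≤ l₀ → Bad K t ⊆
      Finset.univ.image (fun s : SeqOfRecord F θ.ν θ.τ9.M (gA K) (K₀ + K) (K₀ + K) =>
          (⟨K, twoRunKeyA F θ.ν θ.τ9.M (gA K) (K₀ + K) (K₀ + K) s⟩ : Σ K, SiteSeqKey F (K₀ + K)))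
        ∪ Finset.univ.image (fun s' : SeqOfRecord F θ.ν θ.τ9.M (gB K) (K₀ + K + 1) (K₀ + K + 1) =>
          (⟨K, twoRunKeyB F θ.ν hM (gB K) (K₀ + K) (K₀ + K) s'⟩ : Σ K, SiteSeqKey F (K₀ + K))))
    (hW0 : ∀ K, 0 ≤ W K) (hW1 : ∀ K, W K < 1) (hWs : Summable W)
    (hA : ∀ K t, |t| ≤ l₀ →
      ∑ s ∈ Finset.univ.filter (fun s : SeqOfRecord F θ.ν θ.τ9.M (gA K) (K₀ + K) (K₀ + K) =>
          (⟨K, twoRunKeyA F θ.ν θ.τ9.M (gA K) (K₀ + K) (K₀ + K) s⟩ : Σ K, SiteSeqKey F (K₀ + K)) ∈ Bad K t),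
        classWeightOfDatum₉ F N (θ.liveRepin₁₃ F N).toStage9Params D g₀ os ⟨K₀ + K, mA K, cA K⟩ (gA K) (K₀ + K) t s
      ≤ W K * ∑ s, classWeightOfDatum₉ F N (θ.liveRepin₁₃ F N).toStage9Params D g₀ os ⟨K₀ + K, mA K, cA K⟩ (gA K) (K₀ + K) t s)
    (hB : ∀ K t, |t| ≤ l₀ →
      ∑ s' ∈ Finset.univ.filter (fun s' : SeqOfRecord F θ.ν θ.τ9.M (gB K) (K₀ + K + 1) (K₀ + K + 1) =>
          (⟨K, twoRunKeyB F θ.ν hM (gB K) (K₀ + K) (K₀ + K) s'⟩ : Σ K, SiteSeqKey F (K₀ + K)) ∈ Bad K t),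
        classWeightOfDatum₉ F N (θ.liveRepin₁₃ F N).toStage9Params D g₀ os ⟨K₀ + K + 1, mB K, cB K⟩ (gB K) (K₀ + K + 1) t s'
      ≤ W K * ∑ s', classWeightOfDatum₉ F N (θ.liveRepin₁₃ F N).toStage9Params D g₀ os ⟨K₀ + K + 1, mB K, cB K⟩ (gB K) (K₀ + K + 1) t s') :
    RelWeightBound l₀
      (fun K => Finset.univ.image (fun s : SeqOfRecord F θ.ν θ.τ9.M (gA K) (K₀ + K) (K₀ + K) =>
          (⟨K, twoRunKeyA F θ.ν θ.τ9.M (gA K) (K₀ + K) (K₀ + K) s⟩ : Σ K, SiteSeqKey F (K₀ + K)))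
        ∪ Finset.univ.image (fun s' : SeqOfRecord F θ.ν θ.τ9.M (gB K) (K₀ + K + 1) (K₀ + K + 1) =>
          (⟨K, twoRunKeyB F θ.ν hM (gB K) (K₀ + K) (K₀ + K) s'⟩ : Σ K, SiteSeqKey F (K₀ + K))))
      (fun K t x => ∑ s ∈ Finset.univ.filter (fun s : SeqOfRecord F θ.ν θ.τ9.M (gA K) (K₀ + K) (K₀ + K) =>
          (⟨K, twoRunKeyA F θ.ν θ.τ9.M (gA K) (K₀ + K) (K₀ + K) s⟩ : Σ K, SiteSeqKey F (K₀ + K)) = x),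
        classWeightOfDatum₉ F N (θ.liveRepin₁₃ F N).toStage9Params D g₀ os ⟨K₀ + K, mA K, cA K⟩ (gA K) (K₀ + K) t s)
      (fun K t x => ∑ s' ∈ Finset.univ.filter (fun s' : SeqOfRecord F θ.ν θ.τ9.M (gB K) (K₀ + K + 1) (K₀ + K + 1) =>
          (⟨K, twoRunKeyB F θ.ν hM (gB K) (K₀ + K) (K₀ + K) s'⟩ : Σ K, SiteSeqKey F (K₀ + K)) = x),
        classWeightOfDatum₉ F N (θ.liveRepin₁₃ F N).toStage9Params D g₀ os ⟨K₀ + K + 1, mB K, cB K⟩ (gB K) (K₀ + K + 1) t s') Bad W :=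
  relWeightBound_keyed_of_termBounds
    (fun K s => (⟨K, twoRunKeyA F θ.ν θ.τ9.M (gA K) (K₀ + K) (K₀ + K) s⟩ : Σ K, SiteSeqKey F (K₀ + K)))
    (fun K s' => (⟨K, twoRunKeyB F θ.ν hM (gB K) (K₀ + K) (K₀ + K) s'⟩ : Σ K, SiteSeqKey F (K₀ + K)))
    (fun K t s => classWeightOfDatum₉ F N (θ.liveRepin₁₃ F N).toStage9Params D g₀ os ⟨K₀ + K, mA K, cA K⟩ (gA K) (K₀ + K) t s)
    (fun K t s' => classWeightOfDatum₉ F N (θ.liveRepin₁₃ F N).toStage9Params D g₀ os ⟨K₀ + K + 1, mB K, cB K⟩ (gB K) (K₀ + K + 1) t s')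
    (mem_imageUnion_left _ _) (mem_imageUnion_right _ _) hBad hW0 hW1 hWs hA hB

/-- ★★ **THE CONVERSE AT B's KEYED DATA**: B :169's `h20` binder SAYS exactly the two term-level relative bounds on the runs' bad sequences — the socket loses nothing; N20's
inhabitant at the record proves precisely these two displayed statements. [bookkeeping] -/
theorem termBounds_of_keyedRelWeight_twoRunKeyed (θ : Stage13Params F N) (hM : 0 < θ.τ9.M) (D : FiniteEpsData F (SU N)) (g₀ : ℕ → ℝ) (os : List (ULoop F))
    (K₀ : ℕ) (mA mB : ℕ → ℕ) (cA cB : ℕ → ℝ) (gA gB : ℕ → ℕ → ℝ)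
    {l₀ : ℝ} {Bad : ℕ → ℝ → Finset (Σ K, SiteSeqKey F (K₀ + K))} {W : ℕ → ℝ}
    (h20 : RelWeightBound l₀
      (fun K => Finset.univ.image (fun s : SeqOfRecord F θ.ν θ.τ9.M (gA K) (K₀ + K) (K₀ + K) =>
          (⟨K, twoRunKeyA F θ.ν θ.τ9.M (gA K) (K₀ + K) (K₀ + K) s⟩ : Σ K, SiteSeqKey F (K₀ + K)))
        ∪ Finset.univ.image (fun s' : SeqOfRecord F θ.ν θ.τ9.M (gB K) (K₀ + K + 1) (K₀ + K + 1) =>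
          (⟨K, twoRunKeyB F θ.ν hM (gB K) (K₀ + K) (K₀ + K) s'⟩ : Σ K, SiteSeqKey F (K₀ + K))))
      (fun K t x => ∑ s ∈ Finset.univ.filter (fun s : SeqOfRecord F θ.ν θ.τ9.M (gA K) (K₀ + K) (K₀ + K) =>
          (⟨K, twoRunKeyA F θ.ν θ.τ9.M (gA K) (K₀ + K) (K₀ + K) s⟩ : Σ K, SiteSeqKey F (K₀ + K)) = x),
        classWeightOfDatum₉ F N (θ.liveRepin₁₃ F N).toStage9Params D g₀ os ⟨K₀ + K, mA K, cA K⟩ (gA K) (K₀ + K) t s)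
      (fun K t x => ∑ s' ∈ Finset.univ.filter (fun s' : SeqOfRecord F θ.ν θ.τ9.M (gB K) (K₀ + K + 1) (K₀ + K + 1) =>
          (⟨K, twoRunKeyB F θ.ν hM (gB K) (K₀ + K) (K₀ + K) s'⟩ : Σ K, SiteSeqKey F (K₀ + K)) = x),
        classWeightOfDatum₉ F N (θ.liveRepin₁₃ F N).toStage9Params D g₀ os ⟨K₀ + K + 1, mB K, cB K⟩ (gB K) (K₀ + K + 1) t s') Bad W) :
    (∀ K t, |t| ≤ l₀ →
      ∑ s ∈ Finset.univ.filter (fun s : SeqOfRecord F θ.ν θ.τ9.M (gA K) (K₀ + K) (K₀ + K) =>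
          (⟨K, twoRunKeyA F θ.ν θ.τ9.M (gA K) (K₀ + K) (K₀ + K) s⟩ : Σ K, SiteSeqKey F (K₀ + K)) ∈ Bad K t),
        classWeightOfDatum₉ F N (θ.liveRepin₁₃ F N).toStage9Params D g₀ os ⟨K₀ + K, mA K, cA K⟩ (gA K) (K₀ + K) t s
      ≤ W K * ∑ s, classWeightOfDatum₉ F N (θ.liveRepin₁₃ F N).toStage9Params D g₀ os ⟨K₀ + K, mA K, cA K⟩ (gA K) (K₀ + K) t s) ∧
    (∀ K t, |t| ≤ l₀ →
      ∑ s' ∈ Finset.univ.filter (fun s' : SeqOfRecord F θ.ν θ.τ9.M (gB K) (K₀ + K + 1) (K₀ + K + 1) =>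
          (⟨K, twoRunKeyB F θ.ν hM (gB K) (K₀ + K) (K₀ + K) s'⟩ : Σ K, SiteSeqKey F (K₀ + K)) ∈ Bad K t),
        classWeightOfDatum₉ F N (θ.liveRepin₁₃ F N).toStage9Params D g₀ os ⟨K₀ + K + 1, mB K, cB K⟩ (gB K) (K₀ + K + 1) t s'
      ≤ W K * ∑ s', classWeightOfDatum₉ F N (θ.liveRepin₁₃ F N).toStage9Params D g₀ os ⟨K₀ + K + 1, mB K, cB K⟩ (gB K) (K₀ + K + 1) t s') :=
  termBounds_of_relWeightBound_keyed
    (fun K s => (⟨K, twoRunKeyA F θ.ν θ.τ9.M (gA K) (K₀ + K) (K₀ + K) s⟩ : Σ K, SiteSeqKey F (K₀ + K)))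
    (fun K s' => (⟨K, twoRunKeyB F θ.ν hM (gB K) (K₀ + K) (K₀ + K) s'⟩ : Σ K, SiteSeqKey F (K₀ + K)))
    (fun K t s => classWeightOfDatum₉ F N (θ.liveRepin₁₃ F N).toStage9Params D g₀ os ⟨K₀ + K, mA K, cA K⟩ (gA K) (K₀ + K) t s)
    (fun K t s' => classWeightOfDatum₉ F N (θ.liveRepin₁₃ F N).toStage9Params D g₀ os ⟨K₀ + K + 1, mB K, cB K⟩ (gB K) (K₀ + K + 1) t s')
    (mem_imageUnion_left _ _) (mem_imageUnion_right _ _) h20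

/-- ★★ **LEAF D's `h20` AT B's KEYED DATA IN THE KP CURRENCY**: per-(K,t) KP pinned-gas dominations of run A's bad sequences (budget `S_A`) and of run B's bad sequences (budget
`S_B`), `S_A, S_B ≥ 0` summable — THE BODY OF N20, DISPLAYED, NOT PROVED — ⇒ B :169's `RelWeightBound` at `W K = 1 − exp (−(S_A K + S_B K))` (§1 ★, `T4WeightBudgetKP`
`relWeightBound_of_polymerDom` BY NAME). [bookkeeping] -/
theorem keyedRelWeight_twoRunKeyed_of_termPolymerDom (θ : Stage13Params F N) (hM : 0 < θ.τ9.M) (D : FiniteEpsData F (SU N)) (g₀ : ℕ → ℝ)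
    (os : List (ULoop F)) (K₀ : ℕ) (mA mB : ℕ → ℕ) (cA cB : ℕ → ℝ) (gA gB : ℕ → ℕ → ℝ)
    {l₀ : ℝ} {Bad : ℕ → ℝ → Finset (Σ K, SiteSeqKey F (K₀ + K))} {SA SB : ℕ → ℝ}
    (hBad : ∀ K t, |t| ≤ l₀ → Bad K t ⊆
      Finset.univ.image (fun s : SeqOfRecord F θ.ν θ.τ9.M (gA K) (K₀ + K) (K₀ + K) =>
          (⟨K, twoRunKeyA F θ.ν θ.τ9.M (gA K) (K₀ + K) (K₀ + K) s⟩ : Σ K, SiteSeqKey F (K₀ + K)))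
        ∪ Finset.univ.image (fun s' : SeqOfRecord F θ.ν θ.τ9.M (gB K) (K₀ + K + 1) (K₀ + K + 1) =>
          (⟨K, twoRunKeyB F θ.ν hM (gB K) (K₀ + K) (K₀ + K) s'⟩ : Σ K, SiteSeqKey F (K₀ + K))))
    (hSA : ∀ K, 0 ≤ SA K) (hSB : ∀ K, 0 ≤ SB K) (hsA : Summable SA) (hsB : Summable SB)
    (hdomA : ∀ K t, |t| ≤ l₀ → ∃ G : PinnedGas, ∃ c : ℝ, 0 ≤ c ∧ G.IsKP ∧
      ∑ s ∈ Finset.univ.filter (fun s : SeqOfRecord F θ.ν θ.τ9.M (gA K) (K₀ + K) (K₀ + K) =>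
          (⟨K, twoRunKeyA F θ.ν θ.τ9.M (gA K) (K₀ + K) (K₀ + K) s⟩ : Σ K, SiteSeqKey F (K₀ + K)) ∈ Bad K t),
        classWeightOfDatum₉ F N (θ.liveRepin₁₃ F N).toStage9Params D g₀ os ⟨K₀ + K, mA K, cA K⟩ (gA K) (K₀ + K) t s ≤ c * G.bad ∧
      c * G.total ≤ ∑ s, classWeightOfDatum₉ F N (θ.liveRepin₁₃ F N).toStage9Params D g₀ os ⟨K₀ + K, mA K, cA K⟩ (gA K) (K₀ + K) t s ∧
      G.pinnedSize ≤ SA K)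
    (hdomB : ∀ K t, |t| ≤ l₀ → ∃ G : PinnedGas, ∃ c : ℝ, 0 ≤ c ∧ G.IsKP ∧
      ∑ s' ∈ Finset.univ.filter (fun s' : SeqOfRecord F θ.ν θ.τ9.M (gB K) (K₀ + K + 1) (K₀ + K + 1) =>
          (⟨K, twoRunKeyB F θ.ν hM (gB K) (K₀ + K) (K₀ + K) s'⟩ : Σ K, SiteSeqKey F (K₀ + K)) ∈ Bad K t),
        classWeightOfDatum₉ F N (θ.liveRepin₁₃ F N).toStage9Params D g₀ os ⟨K₀ + K + 1, mB K, cB K⟩ (gB K) (K₀ + K + 1) t s' ≤ c * G.bad ∧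
      c * G.total ≤ ∑ s', classWeightOfDatum₉ F N (θ.liveRepin₁₃ F N).toStage9Params D g₀ os ⟨K₀ + K + 1, mB K, cB K⟩ (gB K) (K₀ + K + 1) t s' ∧
      G.pinnedSize ≤ SB K) :
    RelWeightBound l₀
      (fun K => Finset.univ.image (fun s : SeqOfRecord F θ.ν θ.τ9.M (gA K) (K₀ + K) (K₀ + K) =>
          (⟨K, twoRunKeyA F θ.ν θ.τ9.M (gA K) (K₀ + K) (K₀ + K) s⟩ : Σ K, SiteSeqKey F (K₀ + K)))
        ∪ Finset.univ.image (fun s' : SeqOfRecord F θ.ν θ.τ9.M (gB K) (K₀ + K + 1) (K₀ + K + 1) =>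
          (⟨K, twoRunKeyB F θ.ν hM (gB K) (K₀ + K) (K₀ + K) s'⟩ : Σ K, SiteSeqKey F (K₀ + K))))
      (fun K t x => ∑ s ∈ Finset.univ.filter (fun s : SeqOfRecord F θ.ν θ.τ9.M (gA K) (K₀ + K) (K₀ + K) =>
          (⟨K, twoRunKeyA F θ.ν θ.τ9.M (gA K) (K₀ + K) (K₀ + K) s⟩ : Σ K, SiteSeqKey F (K₀ + K)) = x),
        classWeightOfDatum₉ F N (θ.liveRepin₁₃ F N).toStage9Params D g₀ os ⟨K₀ + K, mA K, cA K⟩ (gA K) (K₀ + K) t s)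
      (fun K t x => ∑ s' ∈ Finset.univ.filter (fun s' : SeqOfRecord F θ.ν θ.τ9.M (gB K) (K₀ + K + 1) (K₀ + K + 1) =>
          (⟨K, twoRunKeyB F θ.ν hM (gB K) (K₀ + K) (K₀ + K) s'⟩ : Σ K, SiteSeqKey F (K₀ + K)) = x),
        classWeightOfDatum₉ F N (θ.liveRepin₁₃ F N).toStage9Params D g₀ os ⟨K₀ + K + 1, mB K, cB K⟩ (gB K) (K₀ + K + 1) t s') Bad
      fun K => 1 - Real.exp (-(SA K + SB K)) :=
  relWeightBound_keyed_of_termPolymerDom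
    (fun K s => (⟨K, twoRunKeyA F θ.ν θ.τ9.M (gA K) (K₀ + K) (K₀ + K) s⟩ : Σ K, SiteSeqKey F (K₀ + K)))
    (fun K s' => (⟨K, twoRunKeyB F θ.ν hM (gB K) (K₀ + K) (K₀ + K) s'⟩ : Σ K, SiteSeqKey F (K₀ + K)))
    (fun K t s => classWeightOfDatum₉ F N (θ.liveRepin₁₃ F N).toStage9Params D g₀ os ⟨K₀ + K, mA K, cA K⟩ (gA K) (K₀ + K) t s)
    (fun K t s' => classWeightOfDatum₉ F N (θ.liveRepin₁₃ F N).toStage9Params D g₀ os ⟨K₀ + K + 1, mB K, cB K⟩ (gB K) (K₀ + K + 1) t s')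
    (mem_imageUnion_left _ _) (mem_imageUnion_right _ _) hBad hSA hSB hsA hsB hdomA hdomB

/-- **LEAF D's `h20` AT B's KEYED DATA IN THE KP CURRENCY AT A PINNED SLOT** (record-matching form: the carrier-of-record's OWN `W`): the same two dominations with their
own budgets, nonnegative class weights (displayed), and a slot `W` with `1 − e^{−S_A K} ≤ W K`, `1 − e^{−S_B K} ≤ W K`, `0 ≤ W K < 1`, `Σ W < ∞` ⇒ B :169's `RelWeightBound`
at `W` (§1 `relWeightBound_keyed_of_termPolymerDom_slot`). [bookkeeping] -/
theorem keyedRelWeight_twoRunKeyed_of_termPolymerDom_slot (θ : Stage13Params F N) (hM : 0 < θ.τ9.M) (D : FiniteEpsData F (SU N)) (g₀ : ℕ → ℝ)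
    (os : List (ULoop F)) (K₀ : ℕ) (mA mB : ℕ → ℕ) (cA cB : ℕ → ℝ) (gA gB : ℕ → ℕ → ℝ)
    {l₀ : ℝ} {Bad : ℕ → ℝ → Finset (Σ K, SiteSeqKey F (K₀ + K))} {SA SB W : ℕ → ℝ}
    (hBad : ∀ K t, |t| ≤ l₀ → Bad K t ⊆
      Finset.univ.image (fun s : SeqOfRecord F θ.ν θ.τ9.M (gA K) (K₀ + K) (K₀ + K) =>
          (⟨K, twoRunKeyA F θ.ν θ.τ9.M (gA K) (K₀ + K) (K₀ + K) s⟩ : Σ K, SiteSeqKey F (K₀ + K)))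
        ∪ Finset.univ.image (fun s' : SeqOfRecord F θ.ν θ.τ9.M (gB K) (K₀ + K + 1) (K₀ + K + 1) =>
          (⟨K, twoRunKeyB F θ.ν hM (gB K) (K₀ + K) (K₀ + K) s'⟩ : Σ K, SiteSeqKey F (K₀ + K))))
    (ha0 : ∀ K t, |t| ≤ l₀ → ∀ s, 0 ≤ classWeightOfDatum₉ F N (θ.liveRepin₁₃ F N).toStage9Params D g₀ os ⟨K₀ + K, mA K, cA K⟩ (gA K) (K₀ + K) t s)
    (hb0 : ∀ K t, |t| ≤ l₀ → ∀ s', 0 ≤ classWeightOfDatum₉ F N (θ.liveRepin₁₃ F N).toStage9Params D g₀ os ⟨K₀ + K + 1, mB K, cB K⟩ (gB K) (K₀ + K + 1) t s')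
    (hdomA : ∀ K t, |t| ≤ l₀ → ∃ G : PinnedGas, ∃ c : ℝ, 0 ≤ c ∧ G.IsKP ∧
      ∑ s ∈ Finset.univ.filter (fun s : SeqOfRecord F θ.ν θ.τ9.M (gA K) (K₀ + K) (K₀ + K) =>
          (⟨K, twoRunKeyA F θ.ν θ.τ9.M (gA K) (K₀ + K) (K₀ + K) s⟩ : Σ K, SiteSeqKey F (K₀ + K)) ∈ Bad K t),
        classWeightOfDatum₉ F N (θ.liveRepin₁₃ F N).toStage9Params D g₀ os ⟨K₀ + K, mA K, cA K⟩ (gA K) (K₀ + K) t s ≤ c * G.bad ∧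
      c * G.total ≤ ∑ s, classWeightOfDatum₉ F N (θ.liveRepin₁₃ F N).toStage9Params D g₀ os ⟨K₀ + K, mA K, cA K⟩ (gA K) (K₀ + K) t s ∧
      G.pinnedSize ≤ SA K)
    (hdomB : ∀ K t, |t| ≤ l₀ → ∃ G : PinnedGas, ∃ c : ℝ, 0 ≤ c ∧ G.IsKP ∧
      ∑ s' ∈ Finset.univ.filter (fun s' : SeqOfRecord F θ.ν θ.τ9.M (gB K) (K₀ + K + 1) (K₀ + K + 1) =>
          (⟨K, twoRunKeyB F θ.ν hM (gB K) (K₀ + K) (K₀ + K) s'⟩ : Σ K, SiteSeqKey F (K₀ + K)) ∈ Bad K t),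
        classWeightOfDatum₉ F N (θ.liveRepin₁₃ F N).toStage9Params D g₀ os ⟨K₀ + K + 1, mB K, cB K⟩ (gB K) (K₀ + K + 1) t s' ≤ c * G.bad ∧
      c * G.total ≤ ∑ s', classWeightOfDatum₉ F N (θ.liveRepin₁₃ F N).toStage9Params D g₀ os ⟨K₀ + K + 1, mB K, cB K⟩ (gB K) (K₀ + K + 1) t s' ∧
      G.pinnedSize ≤ SB K)
    (hWA : ∀ K, 1 - Real.exp (-SA K) ≤ W K) (hWB : ∀ K, 1 - Real.exp (-SB K) ≤ W K)
    (hW0 : ∀ K, 0 ≤ W K) (hW1 : ∀ K, W K < 1) (hWs : Summable W) :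
    RelWeightBound l₀
      (fun K => Finset.univ.image (fun s : SeqOfRecord F θ.ν θ.τ9.M (gA K) (K₀ + K) (K₀ + K) =>
          (⟨K, twoRunKeyA F θ.ν θ.τ9.M (gA K) (K₀ + K) (K₀ + K) s⟩ : Σ K, SiteSeqKey F (K₀ + K)))
        ∪ Finset.univ.image (fun s' : SeqOfRecord F θ.ν θ.τ9.M (gB K) (K₀ + K + 1) (K₀ + K + 1) =>
          (⟨K, twoRunKeyB F θ.ν hM (gB K) (K₀ + K) (K₀ + K) s'⟩ : Σ K, SiteSeqKey F (K₀ + K))))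
      (fun K t x => ∑ s ∈ Finset.univ.filter (fun s : SeqOfRecord F θ.ν θ.τ9.M (gA K) (K₀ + K) (K₀ + K) =>
          (⟨K, twoRunKeyA F θ.ν θ.τ9.M (gA K) (K₀ + K) (K₀ + K) s⟩ : Σ K, SiteSeqKey F (K₀ + K)) = x),
        classWeightOfDatum₉ F N (θ.liveRepin₁₃ F N).toStage9Params D g₀ os ⟨K₀ + K, mA K, cA K⟩ (gA K) (K₀ + K) t s)
      (fun K t x => ∑ s' ∈ Finset.univ.filter (fun s' : SeqOfRecord F θ.ν θ.τ9.M (gB K) (K₀ + K + 1) (K₀ + K + 1) =>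
          (⟨K, twoRunKeyB F θ.ν hM (gB K) (K₀ + K) (K₀ + K) s'⟩ : Σ K, SiteSeqKey F (K₀ + K)) = x),
        classWeightOfDatum₉ F N (θ.liveRepin₁₃ F N).toStage9Params D g₀ os ⟨K₀ + K + 1, mB K, cB K⟩ (gB K) (K₀ + K + 1) t s') Bad W :=
  relWeightBound_keyed_of_termPolymerDom_slot
    (fun K s => (⟨K, twoRunKeyA F θ.ν θ.τ9.M (gA K) (K₀ + K) (K₀ + K) s⟩ : Σ K, SiteSeqKey F (K₀ + K)))
    (fun K s' => (⟨K, twoRunKeyB F θ.ν hM (gB K) (K₀ + K) (K₀ + K) s'⟩ : Σ K, SiteSeqKey F (K₀ + K)))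
    (fun K t s => classWeightOfDatum₉ F N (θ.liveRepin₁₃ F N).toStage9Params D g₀ os ⟨K₀ + K, mA K, cA K⟩ (gA K) (K₀ + K) t s)
    (fun K t s' => classWeightOfDatum₉ F N (θ.liveRepin₁₃ F N).toStage9Params D g₀ os ⟨K₀ + K + 1, mB K, cB K⟩ (gB K) (K₀ + K + 1) t s')
    (mem_imageUnion_left _ _) (mem_imageUnion_right _ _) hBad ha0 hb0 hdomA hdomB hWA hWB hW0 hW1 hWs

end TwoRunKeyed

end Summit.QuantumFields.YangMills.BalabanUVNodes.N20KeyedRelWeightSocket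

end
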